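import Literature.AnabelianGeometry.EtaleTheta.Discharge.Sec2Prop214iiiBiUpperOfModel
import Literature.AnabelianGeometry.EtaleTheta.SettingModelTateRigidityOfRecord
import Literature.AnabelianGeometry.EtaleTheta.SettingModelTateProp15Quot
import Literature.AnabelianGeometry.EtaleTheta.SettingModelChiYCoordKit
import Literature.AnabelianGeometry.EtaleTheta.SettingModelChiProp15iiQuot
import HarnessLib

/-!
# [EtTh] Prop 2.14 (iii), BI-theta UPPER bound: the binder `hU` («log(Ü) maps Δ^tp_Ÿ̲̲ onto Δ_Θ», GAP G-L2t2-3)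
# DISCHARGED from a `y`-coordinate kit, and the bound `N ∣ 2a` UNCONDITIONAL at the stage-2 (Tate) record

Mochizuki, *The Étale Theta Function and its Frobenioid-theoretic Manifestations* [EtTh], Publ. RIMS 45 (2009),
§1 Prop 1.5 (ii) p.23 ("`F̈¹/F̈² = Hom((Δ^tp_Ÿ)^ell/Δ_Θ, Δ_Θ) = Ẑ·log(Ü)`", "`log(Ü) := ½·log(U)`"), §2 Prop 2.2 (ii) p.37,
Prop 2.14 (iii) pp.50–51 (locators `p.N` = PDF pages of the PRIMS text; bib key `MochizukiEtTh2009`). PROOF-ONLY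
companion (no `def`; seat abc-iut-L2-t2 gen 6, row «P214iii-BI-UPPER», part 3) of this seat's
`Discharge/Sec2Prop214iiiBiUpperCore.lean` / `…OfModel.lean` (the bound `N ∣ 2a` modulo `Prop15iii`, `Prop15ii` and the
binder `hU`), over abc-iut-w5-d140's `YCoordKit` (`KummerDataYCoord.lean`: `log(Ü) := [h ↦ ι(ŷ(h)/2)]`) and the stage-2
(«Tate shear») model of record (abc-iut-L2-t8 `SettingModelTateRigidityOfRecord`, abc-iut-L2-t6 `SettingModelTateProp15*`,
abc-iut-w5-d171 `kummerCoreχq` / `yCoordKitχq`, abc-iut-L2-d1 `Huuχq = dUU l ⋊ G_{ℚ_p}` / `doubleUnderlineχqOfEtaRes`) —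
everything consumed BY NAME.

* `ThetaSetting.YCoordKit.exists_logUdd_rep_geometric_surjective` — for ANY theta setting, a `y`-coordinate kit
  `K` with `ι : Ẑ → Δ_Θ` ONTO, an étale-theta datum with `log(Ü) = K.logUdd`, and a choice `X̲̲`: if every square
  `s² ∈ Ẑ` is the `y`-coordinate of a GEOMETRIC element of `Π^tp_Ÿ̲̲ = Π^tp_Ÿ ∩ Π^tp_X̲̲`, then the `N`-free binder `hU`
  of `Sec2Prop214iiiBiUpperOfModel` holds (the cocycle `h ↦ ι(ŷ(h)/2)` takes the value `ι(s)` there).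
* `SettingModel.exists_logUdd_rep_geometric_surjective_modelχq` — **G-L2t2-3 HOLDS at the stage-2 model** for every
  `E` with `E.logUdd = (yCoordKitχq).logUdd` and every `X̲̲` with `Π^tp_X̲̲ = Huuχq p i j l hl`: witnesses `inl(b^{s²})`
  (`inl_bPowGfp_sq_mem_dtpYddN_one_modelχq`: in `Δ^tp_Ÿ`; the `b`-axis lies in `dUU l`; `ŷ(b^t) = t`);
  `…_modelχ` — the same at the stage-1 χ-model (`yCoordKitχ`, `Huuχ p l`; abc-iut-L6-d5's `inl_bPowGfp_sq_mem_dtpYddN_one`),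
  where it is NV for G-L2t2-3 alone (`Prop15iii` is refuted there, abc-iut-L2-t12).
* **`SettingModel.dvd_two_mul_zExp_of_biIso_over_conj_modelTate`** — at the Tate instance `modelχq p 1 2` and its
  rigidity data OF RECORD `R = X̲̲.rigidData μ compat sec2Hyps h15 L` (`X̲̲ := E_s.doubleUnderlineχqOfEtaRes …`,
  `E_s := K_s.etaleThetaDataOfClass η̈♯`, `K_s` the section datum of ANY continuous Galois section `s`, `h15 :=`
  abc-iut-L2-t6's theorem), for EVERY level `μ`, labelling `L`, theta cocycle `η` and `x ∈ Π^tp_X̲̲`: an automorphism of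
  `B_N(η)` inducing `y ↦ x y x⁻¹` on `Π^tp_Y̲̲` forces `N ∣ 2·zExp(x)` and `N†·l ∣ toZ(x)` — Prop15iii / Prop15ii / hU all
  DISCHARGED (`prop13_prop15_sectionData_modelTate`, the previous bullet): the printed "for any `a·l ∈ Im_N`,
  `2a ≡ 0 (mod N)`" with NO binder beyond the section `s`.
HONEST FRAMING: `modelχq` is a SEMI-SYNTHETIC model of the typed §1 interface — consistency / non-vacuity evidence
for the typed upper bound and for G-L2t2-3 ONLY; nothing of [EtTh] is asserted; no side is taken on [IUTchIII]
Cor 3.12; typed ≠ proved.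
-/

noncomputable section

namespace Literature.AnabelianGeometry.EtaleTheta

open Literature.AnabelianGeometry.SemiGraphs
open scoped IsMulCommutative

namespace ThetaSetting.YCoordKit

variable {p : ℕ} [Fact p.Prime] {D : ThetaSetting p} (K : D.YCoordKit)

/-- **The binder `hU` from a `y`-coordinate kit.** If `ι : Ẑ → Δ_Θ` is onto, `log(Ü)` of the étale-theta datum IS
the kit's class `[h ↦ ι(ŷ(h)/2)]`, and every square `s²` is the `y`-coordinate of a geometric element of `Π^tp_Ÿ̲̲`, then
the kit's `log(Ü)`-cocycle maps the geometric part `Δ^tp_Ÿ̲̲` ONTO `Δ_Θ` (value `ι(s)` at such an element) — the `N`-free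
binder of `DoubleUnderline.ndag_mul_dvd_toZ_of_biIso_over_conj`. [cite: MochizukiEtTh2009, Prop 1.5 (ii) p.23] -/
theorem exists_logUdd_rep_geometric_surjective (hι : Function.Surjective K.iota) {E : D.EtaleThetaData}
    (hE : E.logUdd = K.logUdd) {l : ℕ} (C : E.DoubleUnderline l)
    (hy : ∀ s : SettingModel.ZH, ∃ (g : C.GtpYdduu) (_ : (g : D.PiTemp) ∈ D.DeltaTemp),
      K.y (D.toTheta (g : D.PiTemp)) = s ^ 2) :
    ∃ c : contCocycles (MonoidHom.id D.GtpTheta) D.DeltaTheta (D.GtpYdd.map D.toTheta),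
      (QuotientGroup.mk c : D.H1Theta (D.GtpYdd.map D.toTheta)) = E.logUdd ∧
      ∀ z : D.DeltaTheta, ∃ (g : C.GtpYdduu) (_ : (g : D.PiTemp) ∈ D.DeltaTemp),
        c.1 ⟨D.toTheta g, ⟨g, (Subgroup.mem_inf.1 g.2).1, rfl⟩⟩ = z := by
  refine ⟨⟨K.logUddFun, K.logUddFun_mem⟩, ?_, fun z => ?_⟩
  · rw [hE]; rfl
  · obtain ⟨s, hs⟩ := hι z
    obtain ⟨g, hg, hgs⟩ := hy s
    refine ⟨g, hg, ?_⟩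
    have key : ∀ hev : K.y (D.toTheta (g : D.PiTemp)) ∈ SettingModel.sqHom.range,
        SettingModel.half ⟨_, hev⟩ = s := fun hev => by
      apply SettingModel.sqHom_injective
      rw [SettingModel.sqHom_apply, SettingModel.sqHom_apply, SettingModel.half_sq]
      exact hgs
    exact (congrArg K.iota (key _)).trans hs

end ThetaSetting.YCoordKit

namespace SettingModel

open Literature.AnabelianGeometry.SemiGraphs

variable (p : ℕ) [Fact p.Prime]

/-- **GAP G-L2t2-3 («log(Ü) maps Δ^tp_Ÿ̲̲ onto Δ_Θ») HOLDS at the stage-2 model** `modelχq p i j`, for every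
étale-theta datum whose `log(Ü)` is the kit class of `yCoordKitχq` and every choice `X̲̲` with `Π^tp_X̲̲ = Huuχq p i j l hl`:
the geometric witnesses are `inl(b^{s²}) ∈ Δ^tp_Ÿ ∩ Π^tp_X̲̲` (`y`-coordinate `s²`, the `b`-axis lies in `dUU l`), and
`ι = deltaThetaCoordχq : Ẑ ≅ Δ_Θ`. [cite: MochizukiEtTh2009, Prop 1.5 (ii) p.23] -/
theorem exists_logUdd_rep_geometric_surjective_modelχq (i j : ℤ) (hj : Even j)
    (E : (ThetaSetting.modelχq p i j hj).EtaleThetaData) (hE : E.logUdd = (yCoordKitχq p i j hj).logUdd)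
    (l : ℕ+) (hl : Odd (l : ℕ)) (C : E.DoubleUnderline l) (hCH : C.Huu = Huuχq p i j l hl) :
    ∃ c : contCocycles (MonoidHom.id (ThetaSetting.modelχq p i j hj).GtpTheta) (ThetaSetting.modelχq p i j hj).DeltaTheta
        ((ThetaSetting.modelχq p i j hj).GtpYdd.map (ThetaSetting.modelχq p i j hj).toTheta),
      (QuotientGroup.mk c : (ThetaSetting.modelχq p i j hj).H1Theta _) = E.logUdd ∧
      ∀ z : (ThetaSetting.modelχq p i j hj).DeltaTheta,
        ∃ (g : C.GtpYdduu) (_ : (g : (ThetaSetting.modelχq p i j hj).PiTemp) ∈ (ThetaSetting.modelχq p i j hj).DeltaTemp),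
          c.1 ⟨(ThetaSetting.modelχq p i j hj).toTheta g, ⟨g, (Subgroup.mem_inf.1 g.2).1, rfl⟩⟩ = z := by
  refine (yCoordKitχq p i j hj).exists_logUdd_rep_geometric_surjective ?_ hE C fun s => ?_
  · rw [yCoordKitχq_iota]
    exact (bijective_deltaThetaCoordχq p i j).2
  · have hmem := inl_bPowGfp_sq_mem_dtpYddN_one_modelχq p i j hj s
    have hHuu : (SemidirectProduct.inl (bPowGfp (s ^ 2)) : PiTpχq p i j) ∈ C.Huu := by
      rw [hCH, inl_mem_Huuχq_iff]
      exact bPowGfp_mem_dUU l _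
    exact ⟨⟨SemidirectProduct.inl (bPowGfp (s ^ 2)), Subgroup.mem_inf.2 ⟨(Subgroup.mem_inf.1 hmem).1, hHuu⟩⟩,
      (Subgroup.mem_inf.1 hmem).2, yCoordKitχq_y_inl_bPowGfp p i j hj (s ^ 2)⟩

/-- **G-L2t2-3 at the stage-1 χ-model** `modelχ p` (NV of the binder alone — `Prop15iii` is refuted there): for every
étale-theta datum with `log(Ü) = (yCoordKitχ p).logUdd (= logUddχ p)` and every `X̲̲` with `Π^tp_X̲̲ = Huuχ p l`, the
`log(Ü)`-cocycle maps `Δ^tp_Ÿ̲̲` onto `Δ_Θ` (witnesses `inl(b^{s²})`). [cite: MochizukiEtTh2009, Prop 1.5 (ii) p.23] -/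
theorem exists_logUdd_rep_geometric_surjective_modelχ
    (E : (ThetaSetting.modelχ p).EtaleThetaData) (hE : E.logUdd = (yCoordKitχ p).logUdd)
    (l : ℕ+) (C : E.DoubleUnderline l) (hCH : C.Huu = Huuχ p l) :
    ∃ c : contCocycles (MonoidHom.id (ThetaSetting.modelχ p).GtpTheta) (ThetaSetting.modelχ p).DeltaTheta
        ((ThetaSetting.modelχ p).GtpYdd.map (ThetaSetting.modelχ p).toTheta),
      (QuotientGroup.mk c : (ThetaSetting.modelχ p).H1Theta _) = E.logUdd ∧
      ∀ z : (ThetaSetting.modelχ p).DeltaTheta,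
        ∃ (g : C.GtpYdduu) (_ : (g : (ThetaSetting.modelχ p).PiTemp) ∈ (ThetaSetting.modelχ p).DeltaTemp),
          c.1 ⟨(ThetaSetting.modelχ p).toTheta g, ⟨g, (Subgroup.mem_inf.1 g.2).1, rfl⟩⟩ = z := by
  refine (yCoordKitχ p).exists_logUdd_rep_geometric_surjective ?_ hE C fun s => ?_
  · rw [yCoordKitχ_iota]
    exact (bijective_deltaThetaCoordχ p).2
  · have hmem := inl_bPowGfp_sq_mem_dtpYddN_one p s
    have hHuu : (SemidirectProduct.inl (bPowGfp (s ^ 2)) : PiTpχ p) ∈ C.Huu := by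
      rw [hCH, inl_mem_Huuχ_iff, mem_dUU_iff, levelHom_bPowGfp]
      exact ⟨rfl, rfl⟩
    exact ⟨⟨SemidirectProduct.inl (bPowGfp (s ^ 2)), Subgroup.mem_inf.2 ⟨(Subgroup.mem_inf.1 hmem).1, hHuu⟩⟩,
      (Subgroup.mem_inf.1 hmem).2, yCoordKitχ_y_inl_bPowGfp p (s ^ 2)⟩

variable (l : ℕ+) (hl : Odd (l : ℕ)) {N : ℕ+}
  (μ : (ThetaSetting.modelχq p 1 2 even_two).CyclotomeMod l N)
  (s : GQp p →* (ThetaSetting.modelχq p 1 2 even_two).PiTemp) (hs : Continuous s)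
  (hsec : ∀ σ : GQp p, (ThetaSetting.modelχq p 1 2 even_two).aug (s σ) = σ)
  (hsY : (ThetaSetting.modelχq p 1 2 even_two).GK.map s ≤ (ThetaSetting.modelχq p 1 2 even_two).GtpY)
  (hsYdd : (ThetaSetting.modelχq p 1 2 even_two).GKdd.map s ≤ (ThetaSetting.modelχq p 1 2 even_two).GtpYdd)

/-- **[EtTh] Prop 2.14 (iii), BI-theta UPPER bound «for any `a·l ∈ Im_N`, `2a ≡ 0 (mod N)`», UNCONDITIONAL at the
Tate instance's rigidity data of record.** At `modelχq p 1 2` with `R = X̲̲.rigidData μ compat sec2Hyps h15 L`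
(`X̲̲ := E_s.doubleUnderlineχqOfEtaRes …`, `E_s := K_s.etaleThetaDataOfClass η̈♯` for the section datum `K_s` of ANY
continuous Galois section `s`; `h15 :=` abc-iut-L2-t6's `prop15iii_etaleThetaDataOfClass_etaDdχq`; ANY labelling `L`):
for EVERY mod-`N` theta cocycle `η` and `x ∈ Π^tp_X̲̲`, an automorphism of the model bi-theta environment `B_N(η)`
inducing `y ↦ x y x⁻¹` on `Π^tp_Y̲̲` forces `N ∣ 2·zExp(x)` and `N†·l ∣ toZ(x)` — Prop15iii, Prop15ii and G-L2t2-3 ALL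
discharged at this kernel inhabitant. [cite: MochizukiEtTh2009, Prop 2.14(iii) p.50] -/
theorem dvd_two_mul_zExp_of_biIso_over_conj_modelTate
    (L : (((((kummerCoreχq p 1 2 even_two).toKummerDataOfSection s hs hsec hsY hsYdd).etaleThetaDataOfClass
        (etaDdχq p 1 2 even_two)).doubleUnderlineχqOfEtaRes p 1 2 l hl (eta_res_etaDdχq p 1 2 even_two l hl))).CuspLabels)
    {η : (ThetaSetting.modelχq p 1 2 even_two).GtpYdd.subgroupOf (Huuχq p 1 2 l hl) → MuN p N}
    (hη : η ∈ ((((kummerCoreχq p 1 2 even_two).toKummerDataOfSection s hs hsec hsY hsYdd).etaleThetaDataOfClass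
        (etaDdχq p 1 2 even_two)).doubleUnderlineχqOfEtaRes p 1 2 l hl (eta_res_etaDdχq p 1 2 even_two l hl)).thetaCocycles
        (compat_modelχq p 1 2 even_two) μ) :
    let hC := compat_modelχq p 1 2 even_two
    let hS := ThetaSetting.modelχq_sec2Hyps p 1 2 even_two
    let C := (((kummerCoreχq p 1 2 even_two).toKummerDataOfSection s hs hsec hsY hsYdd).etaleThetaDataOfClass
        (etaDdχq p 1 2 even_two)).doubleUnderlineχqOfEtaRes p 1 2 l hl (eta_res_etaDdχq p 1 2 even_two l hl)
    let h15 := prop15iii_etaleThetaDataOfClass_etaDdχq p hC s hs hsec hsY hsYdd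
    ∀ (x : C.Huu) (α : ((C.rigidData μ hC hS h15 L).modelBi hη).Iso ((C.rigidData μ hC hS h15 L).modelBi hη)),
      (∀ z, ((CycEnvelope.proj (C.rigidData μ hC hS h15 L).augY (C.rigidData μ hC hS h15 L).chi (α.e z) :
            (C.rigidData μ hC hS h15 L).PiY) : C.Huu) =
          x * ((CycEnvelope.proj (C.rigidData μ hC hS h15 L).augY (C.rigidData μ hC hS h15 L).chi z :
            (C.rigidData μ hC hS h15 L).PiY) : C.Huu) * x⁻¹) →
      (N : ℤ) ∣ 2 * C.zExp x ∧
        (if Odd (N : ℕ) then (N : ℤ) else (N : ℤ) / 2) * l ∣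
          Multiplicative.toAdd ((ThetaSetting.modelχq p 1 2 even_two).toZ
            ((x : C.Huu) : (ThetaSetting.modelχq p 1 2 even_two).PiTemp)) := by
  intro hC hS C h15 x α hα
  obtain ⟨-, -, h15ii, -⟩ := prop13_prop15_sectionData_modelTate p s hs hsec hsY hsYdd hC
  exact C.ndag_mul_dvd_toZ_of_biIso_over_conj μ hC hS h15 h15ii L
    (exists_logUdd_rep_geometric_surjective_modelχq p 1 2 even_two _ rfl l hl C rfl) hη x α hα

end SettingModel

end Literature.AnabelianGeometry.EtaleTheta

end
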